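import Summits.FinalStateConjecture.FinalStateConjecture.Theorems.ClusterCompletenessOmegaLimitMultiKerrVacuumChart
import Summits.FinalStateConjecture.FinalStateConjecture.Theorems.ClusterCompletenessOmegaLimitMultiKerrVacuumLimit
import Summits.FinalStateConjecture.FinalStateConjecture.Theorems.ClusterCompletenessOmegaLimitMultiKerrTranslates
import Literature.Geometry.Lorentzian.SpacetimeChartDeviationTransfer
import HarnessLib

/-!
# Crux `ClusterCompleteness.OmegaLimitMultiKerr` (stmt-FinalStateConjecture-14664), line `Sketch` —
# ω-limits of the chart metric of a hole chart of a VACUUM development are vacuum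

Structure lemmas (structure stub `ricAt_hole_omegaLimit_eq_zero`, lead gen 3) for the crux
`OmegaLimitMultiKerr`: step one of the IDENTIFICATION of the late-time ω-limits in the LaSalle
reading of the recur-disjunct — limits of the charted vacuum geometry are vacuum. Everything
analytic is landed; this file is the composition in the crux's hole-chart setting. Notation: `Ψ` is a
hole chart on the boosted Kerr background `B = boostedKerrBackground Λ c M a`, `Ψ^* 𝐠` its chart
metric (`Spacetime.chartMetricExtend`), `Ψ^* 𝐠 − g_{M,a}` its deviation (`Spacetime.deviationExtend`),
`e = Λ∂₀` the Killing translation (`x ↦ x + s • e` preserves the exterior and `g_{M,a}`: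
`add_smul_mem_boostedKerrBackground_domain`, `KerrSchildChart.boostedKerrBilin_add_smul`), and `g`
an ω-limit of the deviation translates.

* `chartMetricExtend_translate_sub_eq`, `supCkENorm_chartMetricExtend_translate_sub_eq` — the
  dictionary between the translates of the CHART METRIC and of the DEVIATION: on the exterior
  `(Ψ^* 𝐠)(x + s e) − (g(x) + g_{M,a}(x)) = (Ψ^* 𝐠 − g_{M,a})(x + s e) − g(x)` (stationarity of
  `g_{M,a}`), hence the two have the same `Cᵏ` sup norms over subsets of the exterior (germ
  invariance, `supCkENorm_congr`): `Cᵏ_loc` convergence of the deviation translates to `g` IS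
  `Cᵏ_loc` convergence of the chart-metric translates to `g + g_{M,a}`;
* `isMetricOn_chartMetricExtend_translate` — a translate `y ↦ (Ψ^* 𝐠)(y + t e)` is a field of
  metric components (`MetricCoord.IsMetricOn`) on an open `V` of the exterior as soon as `Ψ` is an
  immersion at every point of `V + t e` (`KerrSchildChart.isMetricOn_chartMetric`,
  `isInvertible_chartMetric_of_injective`, `isMetricOn_comp_add_right`);
* `ricAt_add_boostedKerrBilin_eq_zero_of_tendsto` — the general composite along any nontrivial
  filter: if the deviation translates `(Ψ^* 𝐠 − g_{M,a})(· + sᵢ e)` of a smooth hole chart of a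
  VACUUM Cauchy development converge to `g` in `supCkENorm K k`, `k ≥ 2`, `K ⊆ V`, the translates
  `V + sᵢ e` eventually consist of immersion points of `Ψ`, and `g + g_{M,a}` is a field of metric
  components on `V`, then `Ric[g + g_{M,a}] = 0` on `K`: the chart-metric translates are
  coordinate-Ricci-flat at immersion points (`ricAt_chartMetricExtend_translate_eq_zero`, i.e.
  `Ric(Ψ^* 𝐠) = Ψ^* Ric(𝐠) = 0`), they converge to `g + g_{M,a}` by the dictionary, and
  Ricci-flatness passes to `supCkENorm`-`C²` limits (`ricAt_eq_zero_of_tendsto_supCkENorm`);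
* `ricAt_hole_omegaLimit_eq_zero` (MAIN, registered closed form) — **an ω-limit `g` of the
  deviation of an IMMERSED hole chart of a vacuum development defines a Ricci-flat chart metric
  `g + g_{M,a,Λ,c}` wherever that sum is a metric**: the convergence hypothesis is verbatim the
  output of `exists_omegaLimit_hole_translate` (`Cᵏ` convergence on every compact subset of the
  exterior along the chart times `T n`), used on the singletons `{x}`;
* `ricAt_hole_omegaLimit_eq_zero_of_late` — the same with the immersion hypothesis only on a LATE
  CERTIFIED NEAR ZONE `{t* > τ₀, r ≤ R(t*)}`, `R → ∞` (the region on which the crux's anchor clause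
  certifies the hole charts), provided `T n → +∞`: the translates by `T n • e` of the neighbourhood
  `V ∩ {t* > t*(x) − 1, r < r(x) + 1}` of `x` eventually lie in that zone
  (`KerrSchildChart.time_add_smul / radius_add_smul`).

Not done here (separate bricks): smoothness of the ω-limit (all-order extraction) and its
nondegeneracy (anchor inheritance), i.e. the hypothesis `MetricCoord.IsMetricOn (g + g_{M,a}) V`;
and the derivation of the immersion property of hole charts on the certified zone from the anchor
(for the flat chart this is `isLocalDiffeomorphAt_of_anchor`;
`ricAt_chartMetricExtend_eq_zero_of_isLocalDiffeomorphAt` records that local diffeomorphisms are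
immersions). Everything is proved; Mathlib + `Literature` + landed `Theorems` files only, no
definitions.

## References
* P. Petersen, *Riemannian Geometry*, 2nd ed., GTM 171, Springer 2006, Ch. 10, §3.2 (curvature
  under `C²` convergence of metrics). [Petersen2006]
* B. O'Neill, *Semi-Riemannian geometry*, Academic Press 1983, Ch. 3, Prop. 3.59 and Lemma 3.52.
  [ONeill1983]
* J. K. Hale, *Ordinary differential equations*, 2nd ed., Krieger 1980, Ch. I, §8 (ω-limit sets).
  [Hale1980]
-/

-- every `Summit.FinalStateConjecture.FinalStateConjecture.…` name repeats the summit = sub-problem segment (D-0017 layout)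
set_option linter.dupNamespace false
-- the normed-group instances on `E4 →L[ℝ] E4 →L[ℝ] ℝ` need one more level of pending instance
-- problems than the default (as in `CoordCurvature.lean`)
set_option maxSynthPendingDepth 3

noncomputable section

open scoped Manifold ContDiff Topology ENNReal
open Set Filter TopologicalSpace

namespace Summit.FinalStateConjecture.FinalStateConjecture.Theorems.ClusterCompleteness

open Literature.Geometry.Lorentzian

/-! ### Dictionary: translates of the chart metric versus translates of the deviation -/

section Dictionary

variable (Λ : lorentzGroup) (c : E4) (M a : ℝ)

/-- **Chart-metric translate minus `g + g_{M,a}` is deviation translate minus `g`** at every point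
`x` of the boosted exterior:
`(Ψ^* 𝐠)(x + s e) − (g(x) + g_{M,a}(x)) = (Ψ^* 𝐠 − g_{M,a})(x + s e) − g(x)`, because `x + s e`
is again a point of the exterior (`add_smul_mem_boostedKerrBackground_domain`), where the extended
deviation is `Ψ^* 𝐠 − g_{M,a}` (`Spacetime.deviationExtend_coe_eq`), and
`g_{M,a}(x + s e) = g_{M,a}(x)` (`KerrSchildChart.boostedKerrBilin_add_smul`, Kerr–Schild 1965, §2:
`∂_{t*}` is Killing). [folklore] -/
theorem chartMetricExtend_translate_sub_eq (𝓢 : Spacetime 4)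
    (Ψ : (boostedKerrBackground Λ c M a).domain → 𝓢.carrier) (g : E4 → E4 →L[ℝ] E4 →L[ℝ] ℝ)
    (s : ℝ) {x : E4} (hx : x ∈ (boostedKerrExterior Λ c M a : Set E4)) :
    𝓢.chartMetricExtend (boostedKerrBackground Λ c M a) Ψ
        (x + s • (Λ : E4 ≃L[ℝ] E4) (EuclideanSpace.single (0 : Fin 4) (1 : ℝ))) -
        (g x + boostedKerrBilin Λ c M a x) =
      𝓢.deviationExtend (boostedKerrBackground Λ c M a) Ψ
        (x + s • (Λ : E4 ≃L[ℝ] E4) (EuclideanSpace.single (0 : Fin 4) (1 : ℝ))) - g x := by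
  have hxs := add_smul_mem_boostedKerrBackground_domain Λ c M a x hx s
  have hdev : 𝓢.deviationExtend (boostedKerrBackground Λ c M a) Ψ
      (x + s • (Λ : E4 ≃L[ℝ] E4) (EuclideanSpace.single (0 : Fin 4) (1 : ℝ))) =
      𝓢.chartMetricExtend (boostedKerrBackground Λ c M a) Ψ
        (x + s • (Λ : E4 ≃L[ℝ] E4) (EuclideanSpace.single (0 : Fin 4) (1 : ℝ))) -
      boostedKerrBilin Λ c M a
        (x + s • (Λ : E4 ≃L[ℝ] E4) (EuclideanSpace.single (0 : Fin 4) (1 : ℝ))) :=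
    𝓢.deviationExtend_coe_eq (boostedKerrBackground Λ c M a) Ψ ⟨_, hxs⟩
  rw [hdev, KerrSchildChart.boostedKerrBilin_add_smul, sub_sub,
    add_comm (boostedKerrBilin Λ c M a x)]

/-- **The `Cᵏ` sup norms agree**: over any subset `K` of the boosted exterior,
`‖(Ψ^* 𝐠)(· + s e) − (g + g_{M,a})‖_{Cᵏ(K)} = ‖(Ψ^* 𝐠 − g_{M,a})(· + s e) − g‖_{Cᵏ(K)}` — the two
functions agree on the open exterior (`chartMetricExtend_translate_sub_eq`), hence have the same
germ at every point of `K`, and the `Cᵏ` sup norm only sees germs (`supCkENorm_congr`). So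
`Cᵏ_loc` convergence of the deviation translates to `g` is `Cᵏ_loc` convergence of the
chart-metric translates to `g + g_{M,a}`. [folklore] -/
theorem supCkENorm_chartMetricExtend_translate_sub_eq (𝓢 : Spacetime 4)
    (Ψ : (boostedKerrBackground Λ c M a).domain → 𝓢.carrier) {K : Set E4}
    (hK : K ⊆ (boostedKerrExterior Λ c M a : Set E4)) (g : E4 → E4 →L[ℝ] E4 →L[ℝ] ℝ) (s : ℝ)
    (k : ℕ) :
    supCkENorm K k (fun x ↦ 𝓢.chartMetricExtend (boostedKerrBackground Λ c M a) Ψ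
        (x + s • (Λ : E4 ≃L[ℝ] E4) (EuclideanSpace.single (0 : Fin 4) (1 : ℝ))) -
        (g x + boostedKerrBilin Λ c M a x)) =
      supCkENorm K k (fun x ↦ 𝓢.deviationExtend (boostedKerrBackground Λ c M a) Ψ
        (x + s • (Λ : E4 ≃L[ℝ] E4) (EuclideanSpace.single (0 : Fin 4) (1 : ℝ))) - g x) := by
  refine supCkENorm_congr fun x hx ↦ ?_
  filter_upwards [(boostedKerrExterior Λ c M a).isOpen.mem_nhds (hK hx)] with y hy
  exact chartMetricExtend_translate_sub_eq Λ c M a 𝓢 Ψ g s hy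

/-- **Translates of the chart metric are metric components where `Ψ` is immersed.** For a smooth
hole chart `Ψ` and an open subset `V` of the boosted exterior, if `dΨ` is injective at every point
of the translate `V + t e`, then `y ↦ (Ψ^* 𝐠)(y + t e)` is a field of metric components on `V`
(`MetricCoord.IsMetricOn`: smooth — `KerrSchildChart.contDiffAt_chartMetric`, O'Neill 1983, Ch. 3,
Lemma 3.35 —, symmetric, and invertible — `isInvertible_chartMetric_of_injective`, p. 90): the
chart metric is a field of metric components on the open set `V + t e`
(`KerrSchildChart.isMetricOn_chartMetric`), and translation preserves this
(`isMetricOn_comp_add_right`). [cite: ONeill1983, Ch. 3, Def. 3.1 and p. 90] -/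
theorem isMetricOn_chartMetricExtend_translate (𝓢 : Spacetime 4)
    {Ψ : (boostedKerrBackground Λ c M a).domain → 𝓢.carrier}
    (hΨ : ContMDiff 𝓘(ℝ, E4) (𝓡 4) ∞ Ψ) {V : Set E4} (hVo : IsOpen V)
    (hV : V ⊆ (boostedKerrExterior Λ c M a : Set E4)) (t : ℝ)
    (hinj : ∀ y ∈ V,
      ∀ hy : y + t • (Λ : E4 ≃L[ℝ] E4) (EuclideanSpace.single (0 : Fin 4) (1 : ℝ)) ∈
        ((boostedKerrBackground Λ c M a).domain : Set E4),
      Function.Injective (mfderiv 𝓘(ℝ, E4) (𝓡 4) Ψ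
        ⟨y + t • (Λ : E4 ≃L[ℝ] E4) (EuclideanSpace.single (0 : Fin 4) (1 : ℝ)), hy⟩)) :
    MetricCoord.IsMetricOn (fun y ↦ 𝓢.chartMetricExtend (boostedKerrBackground Λ c M a) Ψ
      (y + t • (Λ : E4 ≃L[ℝ] E4) (EuclideanSpace.single (0 : Fin 4) (1 : ℝ)))) V := by
  have hWo : IsOpen ((fun y ↦ y + t • (Λ : E4 ≃L[ℝ] E4) (EuclideanSpace.single (0 : Fin 4)
      (1 : ℝ))) '' V) :=
    (Homeomorph.addRight _).isOpenMap V hVo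
  have hWU : (fun y ↦ y + t • (Λ : E4 ≃L[ℝ] E4) (EuclideanSpace.single (0 : Fin 4) (1 : ℝ))) ''
      V ⊆ ((boostedKerrBackground Λ c M a).domain : Set E4) := by
    rintro _ ⟨y, hy, rfl⟩
    exact add_smul_mem_boostedKerrBackground_domain Λ c M a y (hV hy) t
  have hmet : MetricCoord.IsMetricOn (𝓢.chartMetricExtend (boostedKerrBackground Λ c M a) Ψ)
      ((fun y ↦ y + t • (Λ : E4 ≃L[ℝ] E4) (EuclideanSpace.single (0 : Fin 4) (1 : ℝ))) ''
        V) := by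
    refine KerrSchildChart.isMetricOn_chartMetric hΨ
      (Gp := 𝓢.chartMetricExtend (boostedKerrBackground Λ c M a) Ψ)
      (fun z ↦ (𝓢.chartMetricExtend_coe (boostedKerrBackground Λ c M a) Ψ z).symm) hWo hWU ?_
    rintro _ ⟨y, hy, rfl⟩
    have hi := isInvertible_chartMetric_of_injective 𝓢 (boostedKerrBackground Λ c M a) Ψ
      (hinj y hy (add_smul_mem_boostedKerrBackground_domain Λ c M a y (hV hy) t))
    rwa [← Spacetime.chartMetricExtend_coe] at hi
  exact isMetricOn_comp_add_right hmet hVo fun y hy ↦ mem_image_of_mem _ hy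

end Dictionary

/-! ### ω-limits of vacuum hole charts are vacuum -/

section Vacuum

variable {X : Type} [TopologicalSpace X] [ChartedSpace E3 X] [IsManifold (𝓡 3) ∞ X]
  [ConnectedSpace X] {D : InitialDataSet (𝓡 3) X}

/-- **The general composite (any nontrivial filter).** Let `𝒟` be a VACUUM Cauchy development, `Ψ` a
smooth hole chart on `B = boostedKerrBackground Λ c M a`, `e = Λ∂₀`, `V` a subset of the exterior on
which `g + g_{M,a}` is a field of metric components (`MetricCoord.IsMetricOn`, so `V` is open),
`K ⊆ V`, and `sᵢ` translation parameters along a nontrivial filter `l` such that eventually `Ψ` is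
an immersion at every point of `V + sᵢ e` and the deviation translates converge to `g` on `K`:
`supCkENorm K k ((Ψ^* 𝐠 − g_{M,a})(· + sᵢ e) − g) → 0`, `k ≥ 2`. Then `Ric[g + g_{M,a}] = 0` on `K`.
Proof: the chart-metric translates `y ↦ (Ψ^* 𝐠)(y + sᵢ e)` are eventually metric components on `V`
(`isMetricOn_chartMetricExtend_translate`) with `Ric = 0` at the points of `K`
(`ricAt_chartMetricExtend_translate_eq_zero`: `Ric(Ψ^* 𝐠) = Ψ^* Ric(𝐠) = 0` at immersion points,
O'Neill 1983, Ch. 3, Prop. 3.59), they converge to `g + g_{M,a}` in `supCkENorm K k`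
(`supCkENorm_chartMetricExtend_translate_sub_eq`), and Ricci-flatness passes to `supCkENorm`-`C²`
limits (`ricAt_eq_zero_of_tendsto_supCkENorm`, Petersen 2006, Ch. 10, §3.2).
[cite: Petersen2006, Ch. 10 §3.2] -/
theorem ricAt_add_boostedKerrBilin_eq_zero_of_tendsto (𝒟 : VacuumCauchyDevelopment D)
    (Λ : lorentzGroup) (c : E4) (M a : ℝ)
    {Ψ : (boostedKerrBackground Λ c M a).domain → 𝒟.carrier}
    (hΨ : ContMDiff 𝓘(ℝ, E4) (𝓡 4) ∞ Ψ) {k : ℕ} (hk : 2 ≤ k) {g : E4 → E4 →L[ℝ] E4 →L[ℝ] ℝ}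
    {V K : Set E4}
    (hV : V ⊆ (boostedKerrExterior Λ c M a : Set E4))
    (hG : MetricCoord.IsMetricOn (fun x ↦ g x + boostedKerrBilin Λ c M a x) V) (hKV : K ⊆ V)
    {ι : Type*} {l : Filter ι} [l.NeBot] {s : ι → ℝ}
    (hinj : ∀ᶠ i in l, ∀ y ∈ V,
      ∀ hy : y + s i • (Λ : E4 ≃L[ℝ] E4) (EuclideanSpace.single (0 : Fin 4) (1 : ℝ)) ∈
        ((boostedKerrBackground Λ c M a).domain : Set E4),
      Function.Injective (mfderiv 𝓘(ℝ, E4) (𝓡 4) Ψ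
        ⟨y + s i • (Λ : E4 ≃L[ℝ] E4) (EuclideanSpace.single (0 : Fin 4) (1 : ℝ)), hy⟩))
    (hlim : Tendsto (fun i ↦ supCkENorm K k (fun x ↦
      𝒟.toSpacetime.deviationExtend (boostedKerrBackground Λ c M a) Ψ
        (x + s i • (Λ : E4 ≃L[ℝ] E4) (EuclideanSpace.single (0 : Fin 4) (1 : ℝ))) - g x))
      l (𝓝 0)) :
    ∀ x ∈ K, MetricCoord.ricAt (fun x ↦ g x + boostedKerrBilin Λ c M a x) x = 0 := by
  refine ricAt_eq_zero_of_tendsto_supCkENorm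
    (Gs := fun i y ↦ 𝒟.toSpacetime.chartMetricExtend (boostedKerrBackground Λ c M a) Ψ
      (y + s i • (Λ : E4 ≃L[ℝ] E4) (EuclideanSpace.single (0 : Fin 4) (1 : ℝ)))) hk
    (hinj.mono fun i hi ↦
      isMetricOn_chartMetricExtend_translate Λ c M a 𝒟.toSpacetime hΨ hG.isOpen hV (s i) hi)
    hG hKV (hlim.congr fun i ↦ (supCkENorm_chartMetricExtend_translate_sub_eq Λ c M a
      𝒟.toSpacetime Ψ (hKV.trans hV) g (s i) k).symm) fun y hy ↦ hinj.mono fun i hi ↦ ?_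
  have hys := add_smul_mem_boostedKerrBackground_domain Λ c M a y (hV (hKV hy)) (s i)
  exact ricAt_chartMetricExtend_translate_eq_zero 𝒟 (boostedKerrBackground Λ c M a) hΨ _ hys
    (hi y (hKV hy) hys)

/-- **ω-limits of the chart metric of an immersed hole chart of a VACUUM development are vacuum**
(registered structure stub of line `Sketch`, crux stmt-FinalStateConjecture-14664, closed form). Let
`𝒟` be a vacuum Cauchy development, `Ψ` a smooth hole chart on `boostedKerrBackground Λ c M a` which
is an immersion (`dΨ` injective) at every point of its domain, `k ≥ 2`, and `g` an ω-limit of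
the deviation translates along the chart times `T n`: on every compact subset `K` of the boosted
exterior `supCkENorm K k ((Ψ^* 𝐠 − g_{M,a})(· + T n • Λ∂₀) − g) → 0` (verbatim the output of
`exists_omegaLimit_hole_translate`). Then on every subset `V` of the exterior on which the limit
chart metric `g + g_{M,a,Λ,c}` is a field of metric components (smooth, symmetric, invertible:
`MetricCoord.IsMetricOn`) it is Ricci-flat: `Ric[g + g_{M,a}] = 0` on `V`
(`ricAt_add_boostedKerrBilin_eq_zero_of_tendsto` on the singletons `K = {x}`, `x ∈ V`). Step one of
the identification of ω-limits in the LaSalle reading of the crux (Hale 1980, Ch. I, §8): limits of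
the charted vacuum geometry are vacuum (Petersen 2006, Ch. 10, §3.2).
[cite: Petersen2006, Ch. 10 §3.2] -/
theorem ricAt_hole_omegaLimit_eq_zero : ∀ {X : Type} [TopologicalSpace X] [ChartedSpace E3 X] [IsManifold (𝓡 3) ∞ X] [ConnectedSpace X] {D : InitialDataSet (𝓡 3) X} (𝒟 : VacuumCauchyDevelopment D) (Λ : lorentzGroup) (c : E4) (M a : ℝ) (Ψ : (boostedKerrBackground Λ c M a).domain → 𝒟.carrier), ContMDiff 𝓘(ℝ, E4) (𝓡 4) ∞ Ψ → (∀ x : (boostedKerrBackground Λ c M a).domain, Function.Injective (mfderiv 𝓘(ℝ, E4) (𝓡 4) Ψ x)) → ∀ {k : ℕ}, 2 ≤ k → ∀ {g : E4 → E4 →L[ℝ] E4 →L[ℝ] ℝ} {V : Set E4}, V ⊆ (boostedKerrExterior Λ c M a : Set E4) → MetricCoord.IsMetricOn (fun x ↦ g x + boostedKerrBilin Λ c M a x) V → ∀ {T : ℕ → ℝ}, (∀ K ⊆ (boostedKerrExterior Λ c M a : Set E4), IsCompact K → Tendsto (fun n ↦ supCkENorm K k (fun x ↦ 𝒟.toSpacetime.deviationExtend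 (boostedKerrBackground Λ c M a) Ψ (x + T n • (Λ : E4 ≃L[ℝ] E4) (EuclideanSpace.single (0 : Fin 4) (1 : ℝ))) - g x)) atTop (𝓝 0)) → ∀ x ∈ V, MetricCoord.ricAt (fun x ↦ g x + boostedKerrBilin Λ c M a x) x = 0 := by
  intro X _ _ _ _ D 𝒟 Λ c M a Ψ hΨ hinj k hk g V hV hG T hlim x hx
  exact ricAt_add_boostedKerrBilin_eq_zero_of_tendsto 𝒟 Λ c M a hΨ hk hV hG
    (singleton_subset_iff.2 hx) (Eventually.of_forall fun n y _ hy ↦ hinj ⟨_, hy⟩)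
    (hlim {x} (singleton_subset_iff.2 (hV hx)) isCompact_singleton) x (mem_singleton x)

/-- **Late-certified form.** The same conclusion when `Ψ` is only known to be an immersion at the
late points of a CERTIFIED NEAR ZONE `{z | τ₀ < t*(z), r(z) ≤ R(t*(z))}` with `R → ∞` (the region
on which the anchor clause of `Recurs k 𝒟` certifies the hole charts), provided the times `T n` tend
to `+∞`: for `x ∈ V`, the translates by `T n • e` of the neighbourhood
`V' = V ∩ {t*(x) − 1 < t*} ∩ {r < r(x) + 1}` of `x` eventually lie in the zone — `t*` is shifted
by `T n` and `r` is preserved (`KerrSchildChart.time_add_smul / radius_add_smul`), and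
`R(t*) ≥ r(x) + 1` for late `t*` —, `g + g_{M,a}` restricts to a field of metric components on the
open set `V'` (`KerrSchildChart.isMetricOn_mono`), and `ricAt_add_boostedKerrBilin_eq_zero_of_tendsto` applies on `K = {x} ⊆ V'`.
[cite: Petersen2006, Ch. 10 §3.2] -/
theorem ricAt_hole_omegaLimit_eq_zero_of_late (𝒟 : VacuumCauchyDevelopment D) (Λ : lorentzGroup)
    (c : E4) (M a : ℝ) {Ψ : (boostedKerrBackground Λ c M a).domain → 𝒟.carrier}
    (hΨ : ContMDiff 𝓘(ℝ, E4) (𝓡 4) ∞ Ψ) {τ₀ : ℝ} {R : ℝ → ℝ} (hR : Tendsto R atTop atTop)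
    (hinj : ∀ z : (boostedKerrBackground Λ c M a).domain,
      τ₀ < (boostedKerrBackground Λ c M a).time z →
      (boostedKerrBackground Λ c M a).radius z ≤ R ((boostedKerrBackground Λ c M a).time z) →
      Function.Injective (mfderiv 𝓘(ℝ, E4) (𝓡 4) Ψ z))
    {k : ℕ} (hk : 2 ≤ k) {g : E4 → E4 →L[ℝ] E4 →L[ℝ] ℝ} {V : Set E4}
    (hV : V ⊆ (boostedKerrExterior Λ c M a : Set E4))
    (hG : MetricCoord.IsMetricOn (fun x ↦ g x + boostedKerrBilin Λ c M a x) V)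
    {T : ℕ → ℝ} (hT : Tendsto T atTop atTop)
    (hlim : ∀ K ⊆ (boostedKerrExterior Λ c M a : Set E4), IsCompact K →
      Tendsto (fun n ↦ supCkENorm K k (fun x ↦
        𝒟.toSpacetime.deviationExtend (boostedKerrBackground Λ c M a) Ψ
          (x + T n • (Λ : E4 ≃L[ℝ] E4) (EuclideanSpace.single (0 : Fin 4) (1 : ℝ))) - g x))
        atTop (𝓝 0)) :
    ∀ x ∈ V, MetricCoord.ricAt (fun x ↦ g x + boostedKerrBilin Λ c M a x) x = 0 := by
  intro x hx
  -- continuity of the rest-frame chart time `t*(x) = (Λ⁻¹(x − c))⁰` and radius `r(Λ⁻¹(x − c))`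
  have htc : Continuous (boostedKerrBackground Λ c M a).time :=
    (PiLp.continuous_apply 2 _ 0).comp (continuous_poincareInv Λ c)
  have hrc : Continuous (boostedKerrBackground Λ c M a).radius :=
    (Kerr.continuous_radius a).comp (continuous_poincareInv Λ c)
  -- the neighbourhood `V' = V ∩ {t*(x) − 1 < t*} ∩ {r < r(x) + 1}` of `x`
  have hV'o : IsOpen (V ∩ ((boostedKerrBackground Λ c M a).time ⁻¹'
      Ioi ((boostedKerrBackground Λ c M a).time x - 1) ∩
      (boostedKerrBackground Λ c M a).radius ⁻¹'
        Iio ((boostedKerrBackground Λ c M a).radius x + 1))) :=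
    hG.isOpen.inter ((isOpen_Ioi.preimage htc).inter (isOpen_Iio.preimage hrc))
  have hxV' : x ∈ V ∩ ((boostedKerrBackground Λ c M a).time ⁻¹'
      Ioi ((boostedKerrBackground Λ c M a).time x - 1) ∩
      (boostedKerrBackground Λ c M a).radius ⁻¹'
        Iio ((boostedKerrBackground Λ c M a).radius x + 1)) :=
    ⟨hx, sub_one_lt ((boostedKerrBackground Λ c M a).time x),
      lt_add_one ((boostedKerrBackground Λ c M a).radius x)⟩
  have hG' : MetricCoord.IsMetricOn (fun x ↦ g x + boostedKerrBilin Λ c M a x)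
      (V ∩ ((boostedKerrBackground Λ c M a).time ⁻¹'
        Ioi ((boostedKerrBackground Λ c M a).time x - 1) ∩
        (boostedKerrBackground Λ c M a).radius ⁻¹'
          Iio ((boostedKerrBackground Λ c M a).radius x + 1))) :=
    KerrSchildChart.isMetricOn_mono hG hV'o inter_subset_left
  -- eventually `R ≥ r(x) + 1` and the translates of `V'` are late
  obtain ⟨τ₁, hτ₁⟩ := eventually_atTop.1
    (hR.eventually_ge_atTop ((boostedKerrBackground Λ c M a).radius x + 1))
  have hev : ∀ᶠ n in atTop, max τ₀ τ₁ - (boostedKerrBackground Λ c M a).time x + 1 ≤ T n :=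
    hT.eventually_ge_atTop _
  refine ricAt_add_boostedKerrBilin_eq_zero_of_tendsto 𝒟 Λ c M a hΨ hk
    (inter_subset_left.trans hV) hG' (singleton_subset_iff.2 hxV')
    (hev.mono fun n hn y hy hys ↦ ?_)
    (hlim {x} (singleton_subset_iff.2 (hV hx)) isCompact_singleton) x (mem_singleton x)
  have h1 : (boostedKerrBackground Λ c M a).time x - 1 < (boostedKerrBackground Λ c M a).time y :=
    hy.2.1
  have h2 : (boostedKerrBackground Λ c M a).radius y <
      (boostedKerrBackground Λ c M a).radius x + 1 := hy.2.2
  have hlate : τ₀ < (boostedKerrBackground Λ c M a).time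
      (y + T n • (Λ : E4 ≃L[ℝ] E4) (EuclideanSpace.single (0 : Fin 4) (1 : ℝ))) := by
    rw [KerrSchildChart.time_add_smul]
    linarith [le_max_left τ₀ τ₁]
  have hzone : (boostedKerrBackground Λ c M a).radius
      (y + T n • (Λ : E4 ≃L[ℝ] E4) (EuclideanSpace.single (0 : Fin 4) (1 : ℝ))) ≤
      R ((boostedKerrBackground Λ c M a).time
        (y + T n • (Λ : E4 ≃L[ℝ] E4) (EuclideanSpace.single (0 : Fin 4) (1 : ℝ)))) := by
    rw [KerrSchildChart.time_add_smul, KerrSchildChart.radius_add_smul]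
    have h3 := hτ₁ ((boostedKerrBackground Λ c M a).time y + T n)
      (by linarith [le_max_right τ₀ τ₁])
    linarith
  exact hinj ⟨_, hys⟩ hlate hzone

end Vacuum

end Summit.FinalStateConjecture.FinalStateConjecture.Theorems.ClusterCompleteness

end
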